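import Summits.CriticalPhenomena.PercolationContinuityZ3.Theorems.Transplant.SiteZ2Continuity
import Summits.CriticalPhenomena.PercolationContinuityZ3.Theorems.Transplant.SiteKNClosure
import Summits.CriticalPhenomena.PercolationContinuityZ3.Theorems.Transplant.SiteSamePWitnessZdHolds
import HarnessLib

/-!
# Site percolation on `ℤ^d`: `θ^{site}(p_c^{site}) = 0` for every `d ≥ 2`, and the dimension profile

builds on p205010 (kernel theorem, internal audit signed; external expert review pending).

Helper file (`--supports stmt-CriticalPhenomena-4575`). Assembly of the two independent site chains
of the tree:

* `d = 2`: `SiteZ2.sitePercolationContinuity_two` (`SiteZ2Continuity.lean`; Harris–RSW dichotomy for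
  the bond encoding of site percolation: weak Köhler-Schindler–Tassion RSW on the planar dual, square
  annuli, static renormalisation, polynomial continuity);
* `d ≥ 3`: `SiteKN.sitePercolationContinuity_holds` (`SiteKNClosure.lean`; site Kozma–Nitzan gluing
  Conjecture 3 `SiteCSH.siteNearOneGluing_holds` ⇒ site Lemmas 9–12 ⇒ site exploration scheme ⇒ site
  Theorem A);

giving **`sitePercolationContinuity_of_two_le : 2 ≤ d → SitePercolationContinuity d`** — Bernoulli
SITE percolation on the nearest-neighbour lattice `ℤ^d` has no infinite cluster at its own critical
density in every dimension `d ≥ 2` — and, with the sanity facts of `SiteThetaSanity.lean`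
(`d = 0` trivially true, `d = 1` false: `p_c^{site}(ℤ) = 1`, `θ^{site}_ℤ(1) = 1`) packaged by
`SiteSameP.sitePercolationContinuity_iff_of_ne_two`, the complete dimension profile
**`sitePercolationContinuity_iff_ne_one : SitePercolationContinuity d ↔ d ≠ 1`**, the site twin of the
bond family `PercolationContinuity d`.

## References

* H. Kesten, *Percolation theory for mathematicians*, Birkhäuser (1982), §3.4 (d = 2).
* I. Benjamini, O. Schramm, *Percolation beyond `ℤ^d`*, Electron. Comm. Probab. 1 (1996), Conj. 4.
* G. Kozma, A. Nitzan, arXiv:2401.12397 (2024), Theorem 6 (the gluing route, d ≥ 3).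
-/

noncomputable section

namespace Summit.CriticalPhenomena.PercolationContinuityZ3.Theorems.Transplant

namespace SiteContinuity

open Literature.Probability.Percolation Literature.Probability.LatticeModels

/-- **`θ^{site}_{ℤ^d}(p_c^{site}(ℤ^d)) = 0` for every `d ≥ 2`**: Bernoulli site percolation on the
nearest-neighbour lattice `ℤ^d`, `d ≥ 2`, has almost surely no infinite open site cluster at the origin
at its own critical density (`d = 2`: planar Harris–RSW dichotomy; `d ≥ 3`: the site Kozma–Nitzan
chain). [cite: BenjaminiSchramm1996, Conj. 4 and §3] -/
theorem sitePercolationContinuity_of_two_le {d : ℕ} (hd : 2 ≤ d) : SitePercolationContinuity d := by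
  by_cases h3 : 3 ≤ d
  · exact SiteKN.sitePercolationContinuity_holds h3
  · obtain rfl : d = 2 := by omega
    exact SiteZ2.sitePercolationContinuity_two

/-- **The dimension profile of the site family**: `SitePercolationContinuity d ↔ d ≠ 1` — true for
`d = 0` (no infinite cluster at all), FALSE for `d = 1` (`p_c^{site}(ℤ) = 1` and `θ^{site}_ℤ(1) = 1`),
true for `d = 2` (this lane's planar chain) and for every `d ≥ 3` (the site Kozma–Nitzan chain).
[cite: BenjaminiSchramm1996, Conj. 4 and §3] -/
theorem sitePercolationContinuity_iff_ne_one (d : ℕ) : SitePercolationContinuity d ↔ d ≠ 1 := by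
  by_cases hd : d = 2
  · subst hd
    exact ⟨fun _ => by decide, fun _ => SiteZ2.sitePercolationContinuity_two⟩
  · exact SiteSameP.sitePercolationContinuity_iff_of_ne_two hd

end SiteContinuity

end Summit.CriticalPhenomena.PercolationContinuityZ3.Theorems.Transplant

end
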